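import Mathlib
import HarnessLib

/-!
# Stub T5 of line `blowdown-kills-pitch` of crux `SymmetricLiouville`: envelope decay

Crux stmt-NavierStokesRegularity-4053, route `SymmetryModuliCount`.

Pure real analysis. Let `m : ℝ → ℝ` be antitone, `0 ≤ m ≤ Cm`, `m → 0` at `+∞`, and suppose the
MASTER INEQUALITY

  `m L ≤ A₁ m(L/4)² + (A₂/L) ∫₀^{L/4} m²`   (`L > 0`, `A₁, A₂ ≥ 0`).

Then `m L ≤ K/L` for all `L > 0`, for some constant `K`.

Proof (one dyadic induction, smallness from `m → 0`, no real exponents). Put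
`ε = 1/(8(A₁+A₂+1))`, pick `ℓ₁ > 0` with `m ≤ ε` on `[ℓ₁, ∞)`, and `ℓ₀ = N ℓ₁` with
`N = 4A₂Cm²/ε + 1`, so that `J₀ := ∫₀^{ℓ₀} m² ≤ Cm² ℓ₁ + ε² ℓ₀` gives `A₂ J₀/ℓ₀ ≤ 3ε/8`.
With `ℓ_k = 4^k ℓ₀` one proves by induction on `k` the pair of bounds

  `m(ℓ_k) ≤ ε/4^k`  and  `∫₀^{ℓ_k} m² ≤ J₀ + 4ℓ₀ε²(1 − 4^{-k})`:

the integral bound propagates because `∫_{ℓ_k}^{ℓ_{k+1}} m² ≤ 3·4^k ℓ₀ · m(ℓ_k)² ≤ 3ℓ₀ε²/4^k`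
(antitone integrand), and the master inequality at `L = ℓ_{k+1}` gives
`4^{k+1} m(ℓ_{k+1}) ≤ 4A₁ε² + A₂J₀/ℓ₀ + 4A₂ε² ≤ ε/2 + 3ε/8 ≤ ε`.
Finally for `L ≥ ℓ₀` choose `k` with `ℓ_k ≤ L < ℓ_{k+1}` (`exists_nat_pow_near`), so
`m L ≤ m(ℓ_k) ≤ ε/4^k < 4εℓ₀/L`, while for `0 < L < ℓ₀`, `m L ≤ Cm ≤ Cm ℓ₀/L`;
`K = 4εℓ₀ + Cm ℓ₀`.
-/

noncomputable section

set_option linter.dupNamespace false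

open Set Filter MeasureTheory
open scoped Topology

namespace Summit.NavierStokesRegularity.NavierStokesRegularity.Theorems.SymmetryModuliCountSymmetricLiouville

/-- The square of a nonnegative antitone function is antitone. -/
theorem envelopeDecay_sq_antitone {m : ℝ → ℝ} (hanti : Antitone m) (hnn : ∀ L, 0 ≤ m L) :
    Antitone fun s => m s ^ 2 :=
  fun _ t hst => pow_le_pow_left₀ (hnn t) (hanti hst) 2

/-- For a nonnegative antitone `m` with `m ≤ c` on `[a, ∞)`, `∫ₐᵇ m² ≤ (b − a) c²` (`a ≤ b`). -/
theorem envelopeDecay_integral_sq_le {m : ℝ → ℝ} (hanti : Antitone m) (hnn : ∀ L, 0 ≤ m L)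
    {a b c : ℝ} (hab : a ≤ b) (hc : ∀ x, a ≤ x → m x ≤ c) :
    ∫ s in a..b, m s ^ 2 ≤ (b - a) * c ^ 2 := by
  have h1 : ∫ s in a..b, m s ^ 2 ≤ ∫ _ in a..b, c ^ 2 :=
    intervalIntegral.integral_mono_on hab (envelopeDecay_sq_antitone hanti hnn).intervalIntegrable
      intervalIntegrable_const (fun x hx => pow_le_pow_left₀ (hnn x) (hc x hx.1) 2)
  simpa using h1

/-- **Stub T5 — envelope decay.** An antitone envelope `0 ≤ m ≤ Cm` with `m → 0` at `+∞` obeying the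
master inequality `m L ≤ A₁ m(L/4)² + (A₂/L) ∫₀^{L/4} m²` (`A₁, A₂ ≥ 0`) decays at the critical rate
`m L ≤ K/L`. -/
theorem stub_envelopeDecay :
    ∀ (m : ℝ → ℝ) (Cm A₁ A₂ : ℝ), Antitone m → (∀ L, 0 ≤ m L) → (∀ L, m L ≤ Cm) → 0 ≤ A₁ → 0 ≤ A₂ →
      Tendsto m atTop (𝓝 0) →
      (∀ L, 0 < L → m L ≤ A₁ * m (L / 4) ^ 2 + A₂ / L * ∫ s in (0:ℝ)..(L / 4), m s ^ 2) →
      ∃ K : ℝ, ∀ L, 0 < L → m L ≤ K / L := by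
  intro m Cm A₁ A₂ hanti hnn hbd hA₁ hA₂ hlim hmaster
  have hCm : 0 ≤ Cm := (hnn 0).trans (hbd 0)
  have hint : ∀ a b : ℝ, IntervalIntegrable (fun s => m s ^ 2) volume a b :=
    fun a b => (envelopeDecay_sq_antitone hanti hnn).intervalIntegrable
  -- Stage 0: the smallness constant `ε` and the scales `ℓ₁ ≤ ℓ₀`.
  obtain ⟨S, hS_def⟩ : ∃ S : ℝ, S = A₁ + A₂ + 1 := ⟨_, rfl⟩
  have hS : 0 < S := by rw [hS_def]; linarith
  obtain ⟨ε, hε_def⟩ : ∃ ε : ℝ, ε = 1 / (8 * S) := ⟨_, rfl⟩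
  have hε : 0 < ε := by rw [hε_def]; positivity
  have hεS : ε * S = 1 / 8 := by rw [hε_def]; field_simp
  have hsmall : 4 * (A₁ + A₂) * ε ≤ 1 / 2 := by nlinarith
  have hA₂ε : A₂ * ε ≤ 1 / 8 := by nlinarith
  obtain ⟨ℓ₁', hℓ₁'⟩ := eventually_atTop.1 (hlim.eventually_lt_const hε)
  obtain ⟨ℓ₁, hℓ₁_def⟩ : ∃ ℓ₁ : ℝ, ℓ₁ = max ℓ₁' 1 := ⟨_, rfl⟩
  have hℓ₁ : 0 < ℓ₁ := by rw [hℓ₁_def]; exact lt_max_of_lt_right one_pos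
  have hmε : ∀ s, ℓ₁ ≤ s → m s ≤ ε :=
    fun s hs => (hℓ₁' s ((le_max_left _ _).trans (hℓ₁_def ▸ hs))).le
  obtain ⟨N, hN_def⟩ : ∃ N : ℝ, N = 4 * A₂ * Cm ^ 2 / ε + 1 := ⟨_, rfl⟩
  have hN : 1 ≤ N := by
    have : 0 ≤ 4 * A₂ * Cm ^ 2 / ε := by positivity
    rw [hN_def]
    linarith
  obtain ⟨ℓ₀, hℓ₀_def⟩ : ∃ ℓ₀ : ℝ, ℓ₀ = N * ℓ₁ := ⟨_, rfl⟩
  have hℓ₁ℓ₀ : ℓ₁ ≤ ℓ₀ := by rw [hℓ₀_def]; nlinarith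
  have hℓ₀ : 0 < ℓ₀ := hℓ₁.trans_le hℓ₁ℓ₀
  -- The head integral `J₀ = ∫₀^{ℓ₀} m²` and its smallness relative to `ℓ₀`.
  obtain ⟨J₀, hJ₀_def⟩ : ∃ J₀ : ℝ, J₀ = ∫ s in (0:ℝ)..ℓ₀, m s ^ 2 := ⟨_, rfl⟩
  have hJ₀ : J₀ ≤ ℓ₁ * Cm ^ 2 + ℓ₀ * ε ^ 2 := by
    have h1 : ∫ s in (0:ℝ)..ℓ₁, m s ^ 2 ≤ (ℓ₁ - 0) * Cm ^ 2 :=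
      envelopeDecay_integral_sq_le hanti hnn hℓ₁.le fun x _ => hbd x
    have h2 : ∫ s in ℓ₁..ℓ₀, m s ^ 2 ≤ (ℓ₀ - ℓ₁) * ε ^ 2 :=
      envelopeDecay_integral_sq_le hanti hnn hℓ₁ℓ₀ hmε
    have h3 := intervalIntegral.integral_add_adjacent_intervals (hint 0 ℓ₁) (hint ℓ₁ ℓ₀)
    have h4 : 0 ≤ ℓ₁ * ε ^ 2 := by positivity
    rw [hJ₀_def, ← h3]
    linarith
  have hJ₀' : A₂ * J₀ / ℓ₀ ≤ 3 * ε / 8 := by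
    rw [div_le_iff₀ hℓ₀]
    have h1 : A₂ * (ℓ₁ * Cm ^ 2) ≤ ε / 4 * ℓ₀ := by
      rw [hℓ₀_def, hN_def]
      have : ε / 4 * ((4 * A₂ * Cm ^ 2 / ε + 1) * ℓ₁) = A₂ * (ℓ₁ * Cm ^ 2) + ε / 4 * ℓ₁ := by
        field_simp
      rw [this]
      have : 0 ≤ ε / 4 * ℓ₁ := by positivity
      linarith
    have h2 : A₂ * (ℓ₀ * ε ^ 2) ≤ ε / 8 * ℓ₀ :=
      calc A₂ * (ℓ₀ * ε ^ 2) = A₂ * ε * (ε * ℓ₀) := by ring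
        _ ≤ 1 / 8 * (ε * ℓ₀) := mul_le_mul_of_nonneg_right hA₂ε (by positivity)
        _ = ε / 8 * ℓ₀ := by ring
    have h3 : A₂ * J₀ ≤ A₂ * (ℓ₁ * Cm ^ 2 + ℓ₀ * ε ^ 2) := mul_le_mul_of_nonneg_left hJ₀ hA₂
    linarith
  -- Stage 1: the dyadic induction along `ℓ_k = 4^k ℓ₀`.
  have key : ∀ k : ℕ, m (4 ^ k * ℓ₀) ≤ ε / 4 ^ k ∧
      ∫ s in (0:ℝ)..(4 ^ k * ℓ₀), m s ^ 2 ≤ J₀ + 4 * ℓ₀ * ε ^ 2 * (1 - 1 / 4 ^ k) := by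
    intro k
    induction k with
    | zero =>
      refine ⟨?_, ?_⟩
      · simpa using hmε ℓ₀ hℓ₁ℓ₀
      · simp [hJ₀_def]
    | succ k ih =>
      obtain ⟨ih1, ih2⟩ := ih
      have h4k : (1:ℝ) ≤ 4 ^ k := one_le_pow₀ (by norm_num)
      have h4k0 : (0:ℝ) < 4 ^ k := by positivity
      have hL : (0:ℝ) < 4 ^ (k + 1) * ℓ₀ := by positivity
      have hL4 : 4 ^ (k + 1) * ℓ₀ / 4 = 4 ^ k * ℓ₀ := by rw [pow_succ]; ring
      have hmk : 0 ≤ m (4 ^ k * ℓ₀) := hnn _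
      have hℓ₀' : ℓ₀ ≠ 0 := hℓ₀.ne'
      have h4k' : (4:ℝ) ^ k ≠ 0 := h4k0.ne'
      have hI : ∫ s in (0:ℝ)..(4 ^ k * ℓ₀), m s ^ 2 ≤ J₀ + 4 * ℓ₀ * ε ^ 2 := by
        have : 0 ≤ 4 * ℓ₀ * ε ^ 2 * (1 / 4 ^ k) := by positivity
        linarith
      refine ⟨?_, ?_⟩
      · -- the master inequality at `L = ℓ_{k+1}`
        have hM := hmaster _ hL
        rw [hL4] at hM
        have hsq : m (4 ^ k * ℓ₀) ^ 2 ≤ (ε / 4 ^ k) ^ 2 := pow_le_pow_left₀ hmk ih1 2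
        have hT1 : A₁ * m (4 ^ k * ℓ₀) ^ 2 ≤ A₁ * (ε / 4 ^ k) ^ 2 :=
          mul_le_mul_of_nonneg_left hsq hA₁
        have hT2 : A₂ / (4 ^ (k + 1) * ℓ₀) * ∫ s in (0:ℝ)..(4 ^ k * ℓ₀), m s ^ 2 ≤
            A₂ / (4 ^ (k + 1) * ℓ₀) * (J₀ + 4 * ℓ₀ * ε ^ 2) :=
          mul_le_mul_of_nonneg_left hI (by positivity)
        have hgoal : A₁ * (ε / 4 ^ k) ^ 2 + A₂ / (4 ^ (k + 1) * ℓ₀) * (J₀ + 4 * ℓ₀ * ε ^ 2) ≤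
            ε / 4 ^ (k + 1) := by
          -- write the left-hand side over the common denominator `4^(k+1)`
          have e1 : A₁ * (ε / 4 ^ k) ^ 2 + A₂ / (4 ^ (k + 1) * ℓ₀) * (J₀ + 4 * ℓ₀ * ε ^ 2) =
              (4 * A₁ * ε ^ 2 / 4 ^ k + A₂ * J₀ / ℓ₀ + 4 * A₂ * ε ^ 2) / 4 ^ (k + 1) := by
            rw [pow_succ]
            field_simp
            ring
          have hb : 4 * A₁ * ε ^ 2 / 4 ^ k + A₂ * J₀ / ℓ₀ + 4 * A₂ * ε ^ 2 ≤ ε := by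
            have : 4 * A₁ * ε ^ 2 / 4 ^ k ≤ 4 * A₁ * ε ^ 2 :=
              div_le_self (by positivity) h4k
            nlinarith
          rw [e1]
          exact div_le_div_of_nonneg_right hb (by positivity)
        linarith
      · -- the integral bound propagates
        have hkk : (4:ℝ) ^ k * ℓ₀ ≤ 4 ^ (k + 1) * ℓ₀ := by
          rw [pow_succ]; nlinarith
        have hsplit := intervalIntegral.integral_add_adjacent_intervals (hint 0 (4 ^ k * ℓ₀))
          (hint (4 ^ k * ℓ₀) (4 ^ (k + 1) * ℓ₀))
        have hpiece : ∫ s in (4 ^ k * ℓ₀)..(4 ^ (k + 1) * ℓ₀), m s ^ 2 ≤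
            (4 ^ (k + 1) * ℓ₀ - 4 ^ k * ℓ₀) * m (4 ^ k * ℓ₀) ^ 2 :=
          envelopeDecay_integral_sq_le hanti hnn hkk fun x hx => hanti hx
        have hsq : m (4 ^ k * ℓ₀) ^ 2 ≤ (ε / 4 ^ k) ^ 2 := pow_le_pow_left₀ hmk ih1 2
        have hpiece' : (4 ^ (k + 1) * ℓ₀ - 4 ^ k * ℓ₀) * m (4 ^ k * ℓ₀) ^ 2 ≤
            3 * ℓ₀ * ε ^ 2 / 4 ^ k := by
          calc (4 ^ (k + 1) * ℓ₀ - 4 ^ k * ℓ₀) * m (4 ^ k * ℓ₀) ^ 2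
              ≤ (4 ^ (k + 1) * ℓ₀ - 4 ^ k * ℓ₀) * (ε / 4 ^ k) ^ 2 :=
                mul_le_mul_of_nonneg_left hsq (by linarith)
            _ = 3 * ℓ₀ * ε ^ 2 / 4 ^ k := by rw [pow_succ]; field_simp; ring
        have e2 : J₀ + 4 * ℓ₀ * ε ^ 2 * (1 - 1 / 4 ^ (k + 1)) =
            J₀ + 4 * ℓ₀ * ε ^ 2 * (1 - 1 / 4 ^ k) + 3 * ℓ₀ * ε ^ 2 / 4 ^ k := by
          rw [pow_succ]; field_simp; ring
        rw [← hsplit, e2]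
        linarith
  -- Stage 2: the final assembly.
  refine ⟨4 * ε * ℓ₀ + Cm * ℓ₀, fun L hL => ?_⟩
  have hK : 4 * ε * ℓ₀ ≤ 4 * ε * ℓ₀ + Cm * ℓ₀ := by nlinarith
  have hK' : Cm * ℓ₀ ≤ 4 * ε * ℓ₀ + Cm * ℓ₀ := by nlinarith
  rcases lt_or_ge L ℓ₀ with h | h
  · calc m L ≤ Cm := hbd L
      _ = Cm * ℓ₀ / ℓ₀ := by field_simp
      _ ≤ Cm * ℓ₀ / L := div_le_div_of_nonneg_left (by positivity) hL h.le
      _ ≤ (4 * ε * ℓ₀ + Cm * ℓ₀) / L := by gcongr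
  · obtain ⟨k, hk1, hk2⟩ := exists_nat_pow_near (x := L / ℓ₀) (y := (4:ℝ))
      (by rwa [le_div_iff₀ hℓ₀, one_mul]) (by norm_num)
    have hk1' : 4 ^ k * ℓ₀ ≤ L := by rwa [le_div_iff₀ hℓ₀] at hk1
    have hk2' : L < 4 ^ (k + 1) * ℓ₀ := by rwa [div_lt_iff₀ hℓ₀] at hk2
    calc m L ≤ m (4 ^ k * ℓ₀) := hanti hk1'
      _ ≤ ε / 4 ^ k := (key k).1
      _ = 4 * ε * ℓ₀ / (4 ^ (k + 1) * ℓ₀) := by rw [pow_succ]; field_simp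
      _ ≤ 4 * ε * ℓ₀ / L := div_le_div_of_nonneg_left (by positivity) hL hk2'.le
      _ ≤ (4 * ε * ℓ₀ + Cm * ℓ₀) / L := by gcongr

end Summit.NavierStokesRegularity.NavierStokesRegularity.Theorems.SymmetryModuliCountSymmetricLiouville
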